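/-
Copyright: cell pub-balaban-gaps (YM BLITZ Y1, track G1), seat g1-p2 GEN 4 (unit `pub-balaban-gaps-g1-p2`).  Row (D4) NODE O,
OBJECT ∕ MECHANISM level: (v)⁺ `ExistsUniformAcrossSmall` INHABITED WITH THE GEOMETRIC σ-MECHANISM — the Γ-kernel slot is a GLUED
inverse `S·(1 − R)⁻¹` over domain-localised seed ∕ step data (`D4WalkOneScale`), so that σ enters through CHAINS reaching the
σ-region while the row bonds stay `R_σ`-far from it (g1-plan-1 N21-1∕N21-2: with one-step Γ-kernels the row-far hypothesis kills
or λ-bounds the σ-part; with glued families the σ-line of `SmallTheta` is geometric).  HONEST FRAMING: a MODEL family; nothing of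
Bałaban's constructed or asserted; (D4) NOT discharged (instance 0∕1); NOT BetaPertH, NOT continuum, NOT Clay.
-/
import Summits.QuantumFields.BalabanUV.Gaps.D4WalkOneScale
import Summits.QuantumFields.BalabanUV.Gaps.D4WalkModelAcross

/-!
# `Gaps.D4WalkModelGlued` — a model (2.14)-term whose Γ-kernel is the glued one-scale inverse `S·(1 − R)⁻¹`, and (v)⁺ across
# tori for families of such terms (cell pub-balaban-gaps, seat g1-p2 gen 4)

HONEST DEPENDENCY (cell pub-balaban, verbatim): continuum YM on T⁴ ⇐ BetaPertH ∧ nine spine estimates (0/9 proved);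
BetaPertH ⇐ (D1) ∧ (D4) ∧ CAP+tail.

WHAT.  `GluedModelTerm`: row bonds `Λ`, extra columns `C₀`, σ-region `X`, a domain-localised SEED family `S` (`Λ × (Λ ⊕ C₀)`) and
STEP family `R` (`(Λ ⊕ C₀) × (Λ ⊕ C₀)`) with real reference values; `toKernels`: precision `A = 1` (free), Γ-kernel
`G(σ,u) = S(σ,u)·(1 − R(σ,u))⁻¹` ([B9] (3.87)–(3.90)), reference `Γ₀ = S₀·(1 − R₀)⁻¹` REAL with `hG0` PROVED (inverse and product
commute with complexification — `inv_map_algebraMap`); `termWalkData`: ONE package `(R, ε₀ − 3μ, κ₀ − 2μ, K̄_glued, 1, 1, R_σ)`,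
`K̄_glued = (mc_μ)·K̄_S·(1·(1 − q)⁻¹)·c_μ`, from `D4WalkOneScale.jointWalkExpansion_oneScale` (Γ-slot) and the identity (other
slots); `acrossSmall_glued`: `ExistsUniformAcrossSmall` for any family of such members with common letters.  Here the σ-carrying
terms of the Γ-kernel are the CHAINS `T_S(ω₀)·T_R(ω₁)⋯` whose seed or steps have domains meeting `X`; their walk distances pass
THROUGH `X` (`through_chainDist_*`) while the rows may be `R_σ`-far from `X` with no constraint on the families' letters — so the
σ-line `2K̄(e^{−(ε₀−3μ)R_σ} + α∕R) ≤ θ₀` is a condition on `R_σ` and `α∕R` at fixed couplings: print's mechanism ([II] p. 13, p. 16).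
Nothing about Bałaban's `Γ_k(Z₀,σ,𝐔,𝐉)`, `Δ^{(k)}`, `C^{(k)}`; census instance of row (D4) = Bałaban's family: 0∕1 UNCHANGED.
-/

noncomputable section

namespace Summit.QuantumFields.BalabanUV.Gaps.D4WalkModelGlued

open Metric Set Finset
open Literature.MathematicalPhysics.QuantumFieldTheory.Balaban1983to89
open Literature.MathematicalPhysics.QuantumFieldTheory.Balaban1983to89.B9SectDWalk (Through MajSumLe DomBy)
open Literature.MathematicalPhysics.QuantumFieldTheory.Balaban1983to89.B9Thm34Ext (toB6)
open Literature.MathematicalPhysics.QuantumFieldTheory.Balaban1983to89.B9Thm37GlueTorus (torusGeom tdist1 tdist1_nonneg)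
open Literature.MathematicalPhysics.QuantumFieldTheory.Balaban1983to89.TreeLengthTorus (TPt)
open Literature.MathematicalPhysics.QuantumFieldTheory.Balaban1983to89.B5TorusCover (UT)
open Literature.MathematicalPhysics.QuantumFieldTheory.Balaban1983to89.B11SectG (RowSum)
open Literature.MathematicalPhysics.QuantumFieldTheory.Balaban1983to89.B13JointWalkExpansion (JointWalkExpansion WalkMajorants)
open Literature.MathematicalPhysics.QuantumFieldTheory.Balaban1983to89.B13TermWalkData
  (WalkConsts TermKernels TermWalkData TorusTerms)
open Literature.MathematicalPhysics.QuantumFieldTheory.Balaban1983to89.B13TermWalkDataOneTorus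
  (SmallTheta ExistsUniformAcrossSmall acrossSmall_of_decay)
open Literature.MathematicalPhysics.QuantumFieldTheory.Balaban1983to89.B13DomainKernelWalks (DomainTerms)
open Summit.QuantumFields.BalabanUV.Gaps.D4WalkOneScale (jointWalkExpansion_oneScale)
open Summit.QuantumFields.BalabanUV.Gaps.D4WalkModelAcross (ModelTerm)

/-! ## §1. Complexification commutes with inverses and products (so the reference Γ-kernel is real) -/

section Real

variable {n : Type} [Fintype n] [DecidableEq n]

/-- The inverse of the complexification of a real matrix is the complexification of its inverse (both sides `0` in the singular
case). -/
theorem inv_map_algebraMap (M : Matrix n n ℝ) : (M.map (algebraMap ℝ ℂ))⁻¹ = M⁻¹.map (algebraMap ℝ ℂ) := by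
  by_cases h : IsUnit M.det
  · apply Matrix.inv_eq_right_inv
    rw [← Matrix.map_mul, Matrix.mul_nonsing_inv _ h, Matrix.map_one _ (map_zero _) (map_one _)]
  · have h' : ¬IsUnit (M.map (algebraMap ℝ ℂ)).det := by
      rw [← RingHom.mapMatrix_apply, ← RingHom.map_det, isUnit_iff_ne_zero, map_ne_zero, ← isUnit_iff_ne_zero]
      exact h
    rw [Matrix.nonsing_inv_apply_not_isUnit _ h', Matrix.nonsing_inv_apply_not_isUnit _ h,
      Matrix.map_zero _ (map_zero _)]

end Real

/-! ## §2. The glued model term -/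

section Model

variable {d N' : ℕ} {ν : ℕ} {Nf : Fin ν → ℕ} [∀ i, NeZero (Nf i)]
variable {E : Type*} [NormedAddCommGroup E] [NormedSpace ℂ E]

/-- GLUED MODEL TERM DATUM (Type-valued, nothing asserted): row bonds `Λ`, extra columns `C₀`, locators, σ-region `X`, fibre bounds
of both locators, domain-localised seed family `S` and step family `R` with real reference values. -/
structure GluedModelTerm (d N' ν : ℕ) (Nf : Fin ν → ℕ) [∀ i, NeZero (Nf i)]
    (E : Type*) [NormedAddCommGroup E] [NormedSpace ℂ E] where
  Λ : Type
  [instFintype : Fintype Λ]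
  [instDecEq : DecidableEq Λ]
  C₀ : Type
  [instFintypeC : Fintype C₀]
  [instDecEqC : DecidableEq C₀]
  locΛ : Λ → UT Nf
  locN : Λ ⊕ C₀ → UT Nf
  X : Finset (UT Nf)
  m : ℕ
  hfib : ∀ x : UT Nf, (Finset.univ.filter fun i => locΛ i = x).card ≤ m
  mN : ℕ
  hfibN : ∀ x : UT Nf, (Finset.univ.filter fun k => locN k = x).card ≤ mN
  S : DomainTerms d N' ν Nf Λ (Λ ⊕ C₀) E
  R : DomainTerms d N' ν Nf (Λ ⊕ C₀) (Λ ⊕ C₀) E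
  hrealS : ∀ i j, (S.kernel 0 0 i j).im = 0
  hrealR : ∀ i j, (R.kernel 0 0 i j).im = 0

/-- The row index of a glued model term is a finite type (bundled instance, exposed). -/
instance GluedModelTerm.instFintypeΛ (t : GluedModelTerm d N' ν Nf E) : Fintype t.Λ := t.instFintype

/-- The row index of a glued model term has decidable equality (bundled instance, exposed). -/
instance GluedModelTerm.instDecEqΛ (t : GluedModelTerm d N' ν Nf E) : DecidableEq t.Λ := t.instDecEq

/-- The extra column index of a glued model term is a finite type (bundled instance, exposed). -/
instance GluedModelTerm.instFintypeC₀ (t : GluedModelTerm d N' ν Nf E) : Fintype t.C₀ := t.instFintypeC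

/-- The extra column index of a glued model term has decidable equality (bundled instance, exposed). -/
instance GluedModelTerm.instDecEqC₀ (t : GluedModelTerm d N' ν Nf E) : DecidableEq t.C₀ := t.instDecEqC

namespace GluedModelTerm

variable (c : B13.Consts) (t : GluedModelTerm d N' ν Nf E)

/-- The glued Γ-kernel `G(σ,u) = S(σ,u)·(1 − R(σ,u))⁻¹` ([B9] (3.87)–(3.90)). -/
def G2 : (TPt d N' → ℂ) → E → Matrix t.Λ (t.Λ ⊕ t.C₀) ℂ :=
  fun σ u => t.S.kernel σ u * ((1 : Matrix (t.Λ ⊕ t.C₀) (t.Λ ⊕ t.C₀) ℂ) + (-1 : ℂ) • t.R.kernel σ u)⁻¹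

/-- The real reference seed `S₀ = Re S(0,0)` and step `R₀ = Re R(0,0)`. -/
def refS : Matrix t.Λ (t.Λ ⊕ t.C₀) ℝ := (t.S.kernel 0 0).map Complex.re

/-- The real reference step `R₀ = Re R(0,0)`. -/
def refR : Matrix (t.Λ ⊕ t.C₀) (t.Λ ⊕ t.C₀) ℝ := (t.R.kernel 0 0).map Complex.re

/-- The seed kernel at the reference point is the complexification of its real part. -/
theorem kernelS_zero_eq : t.S.kernel 0 0 = t.refS.map (algebraMap ℝ ℂ) := by
  ext i j; simp only [refS, Matrix.map_apply]; apply Complex.ext <;> simp [t.hrealS i j]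

/-- The step kernel at the reference point is the complexification of its real part. -/
theorem kernelR_zero_eq : t.R.kernel 0 0 = t.refR.map (algebraMap ℝ ℂ) := by
  ext i j; simp only [refR, Matrix.map_apply]; apply Complex.ext <;> simp [t.hrealR i j]

/-- `1 − R(0,0)` is the complexification of `1 − R₀`. -/
theorem one_sub_kernelR_zero_eq :
    (1 : Matrix (t.Λ ⊕ t.C₀) (t.Λ ⊕ t.C₀) ℂ) + (-1 : ℂ) • t.R.kernel 0 0 =
      ((1 : Matrix (t.Λ ⊕ t.C₀) (t.Λ ⊕ t.C₀) ℝ) - t.refR).map (algebraMap ℝ ℂ) := by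
  rw [kernelR_zero_eq]
  ext i j
  simp only [Matrix.add_apply, Matrix.smul_apply, Matrix.map_apply, Matrix.sub_apply, Matrix.one_apply, smul_eq_mul, map_sub]
  split_ifs <;> simp [sub_eq_add_neg]

/-- **The reference Γ-kernel is REAL**: `G(0,0) = (S₀·(1 − R₀)⁻¹).map ofReal`. -/
theorem G2_zero_eq : t.G2 0 0 = (t.refS * ((1 : Matrix (t.Λ ⊕ t.C₀) (t.Λ ⊕ t.C₀) ℝ) - t.refR)⁻¹).map (algebraMap ℝ ℂ) := by
  unfold G2
  rw [one_sub_kernelR_zero_eq, inv_map_algebraMap, kernelS_zero_eq, ← Matrix.map_mul]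

/-- The glued model `TermKernels` record: precision `A = 1`, `C = 1 ≻ 0`, Γ-kernel `S·(1 − R)⁻¹`, `Γ₀ = S₀·(1 − R₀)⁻¹`. -/
def toKernels : TermKernels c d N' ν Nf E where
  Λ := t.Λ
  C₀ := t.C₀
  A2 := fun _ _ => 1
  G2 := t.G2
  Γ₀ := t.refS * ((1 : Matrix (t.Λ ⊕ t.C₀) (t.Λ ⊕ t.C₀) ℝ) - t.refR)⁻¹
  C := 1
  locΛ := t.locΛ
  locN := t.locN
  X := t.X
  m := t.m
  hfib := t.hfib
  hG0 := t.G2_zero_eq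
  hC0 := by rw [inv_one, Matrix.map_one _ (map_zero _) (map_one _)]
  hC := Matrix.PosDef.one

/-! ## §3. `TermWalkData` with ONE torus-free package -/

variable {c t}

/-- **`TermWalkData` FOR THE GLUED MODEL TERM.**  Seed `S` and step `R` domain-local with letters `(R, λ_S ∕ λ_R, r, m_J, n_D)`
(`λ_•, κ₁ ≥ 0`); one row-sum rate `μ` (constant `c_μ ≥ 0`); rates `0 ≤ μ`, `3μ ≤ ε₀`, `2μ ≤ κ₀`, `κ₀ + μ ≤ ρ₀ − ε₀`; margin
`q = (m_Nc_μ)((m_Nc_μ)·1·(1·K̄_R)c_μ)c_μ < 1`; rows `R_σ`-far from `X`.  Package: `(R, ε₀ − 3μ, κ₀ − 2μ, K̄_glued, 1, 1, R_σ)`,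
`K̄_glued = (m_Nc_μ)·K̄_S·(1·(1 − q)⁻¹)·c_μ`, `K̄_• = λ_•e^{κ₁m_J}e^{2ρ₀r}e^{μr}n_Dc_μ` — no letter depends on the torus. -/
theorem termWalkData {R lamS lamR r : ℝ} {mJ nD : ℕ} {ρ₀ ε₀ κ₀ μ cμ Rσ : ℝ}
    (hS : t.S.IsDomainLocal c t.locΛ t.locN t.X R lamS r mJ nD) (hR : t.R.IsDomainLocal c t.locN t.locN t.X R lamR r mJ nD)
    (hκ₁ : 0 ≤ c.κ₁) (hlamS : 0 ≤ lamS) (hlamR : 0 ≤ lamR)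
    (hμ : 0 ≤ μ) (hμε : 3 * μ ≤ ε₀) (hμκ : 2 * μ ≤ κ₀) (hwin : κ₀ + μ ≤ ρ₀ - ε₀) (hcμ : 0 ≤ cμ)
    (hrow : RowSum (toB6 (torusGeom Nf 0 0 0) 0 True) μ cμ)
    (hq : (t.mN * cμ) * ((t.mN * cμ) * 1 *
      (1 * ((lamR * Real.exp (c.κ₁ * mJ) * Real.exp (2 * ρ₀ * r)) * Real.exp (μ * r) * (nD * cμ))) * cμ) * cμ < 1)
    (hfar : ∀ b : t.Λ, ∀ z ∈ t.X, Rσ ≤ tdist1 Nf (t.locΛ b) z) :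
    TermWalkData (t.toKernels c)
      ⟨R, ε₀ - 3 * μ, κ₀ - 2 * μ,
        (t.mN * cμ) * ((lamS * Real.exp (c.κ₁ * mJ) * Real.exp (2 * ρ₀ * r)) * Real.exp (μ * r) * (nD * cμ)) *
          (1 * (1 - (t.mN * cμ) * ((t.mN * cμ) * 1 *
            (1 * ((lamR * Real.exp (c.κ₁ * mJ) * Real.exp (2 * ρ₀ * r)) * Real.exp (μ * r) * (nD * cμ))) * cμ) * cμ)⁻¹) * cμ,
        1, 1, Rσ⟩ := by
  obtain ⟨W, T, SX, A, D, ρ', hJ, -⟩ :=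
    jointWalkExpansion_oneScale hS hR hκ₁ hlamS hlamR hμ hμε hμκ hwin hcμ hrow t.hfibN hq
  refine ⟨⟨W, T, SX, A, D, ρ', hJ⟩, ?_, ?_, hfar⟩
  · exact ⟨Unit, fun _ _ _ => 1, ∅, fun _ => 1, fun _ => tdist1 Nf, (κ₀ - 2 * μ) + (ε₀ - 3 * μ),
      ModelTerm.jointWalkExpansion_one (d := d) (N' := N') (E := E) c t.locΛ t.X R (ε₀ - 3 * μ) (κ₀ - 2 * μ)⟩
  · exact ⟨Unit, fun _ _ _ => (1 : Matrix t.Λ t.Λ ℂ)⁻¹, fun _ => 1, fun _ => tdist1 Nf, κ₀ - 2 * μ,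
      ModelTerm.walkMajorants_one_inv (d := d) (N' := N') (E := E) c t.locΛ R (κ₀ - 2 * μ)⟩

end GluedModelTerm

end Model

/-! ## §4. (v)⁺ across a family of glued model members — σ-smallness by GEOMETRY -/

section Across

variable {d : ℕ}

/-- GLUED MODEL MEMBER: own torus, configuration space, term index, glued model term per term. -/
structure GluedModelMember (d : ℕ) where
  N' : ℕ
  ν : ℕ
  Nf : Fin ν → ℕ
  [instNf : ∀ i, NeZero (Nf i)]
  E : Type
  [instE₁ : NormedAddCommGroup E]
  [instE₂ : NormedSpace ℂ E]
  ι : Type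
  t : ι → GluedModelTerm d N' ν Nf E

/-- The member's torus side lengths are non-zero (bundled instance, exposed). -/
instance GluedModelMember.instNeZeroNf (M : GluedModelMember d) (i : Fin M.ν) : NeZero (M.Nf i) := M.instNf i

/-- The member's configuration space is a normed group (bundled instance, exposed). -/
instance GluedModelMember.instNormedAddCommGroupE (M : GluedModelMember d) : NormedAddCommGroup M.E := M.instE₁

/-- The member's configuration space is a complex normed space (bundled instance, exposed). -/
instance GluedModelMember.instNormedSpaceE (M : GluedModelMember d) : NormedSpace ℂ M.E := M.instE₂

/-- The member as a `TorusTerms` record. -/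
def GluedModelMember.toTorusTerms (c : B13.Consts) (M : GluedModelMember d) : TorusTerms c d where
  N' := M.N'
  ν := M.ν
  Nf := M.Nf
  E := M.E
  ι := M.ι
  𝒦 := fun i => (M.t i).toKernels c

variable {c : B13.Consts}

/-- **(v)⁺ ACROSS A FAMILY OF GLUED MODEL MEMBERS, σ-SMALLNESS BY GEOMETRY.**  Common letters `(R, λ_S, λ_R, r, m_J, n_D)`, common
middle fibre bound `m_N`, one row-sum rate `μ` with constant `c_μ` on every member's torus, rates as in §3 with `2μ < κ₀`, margin
`q < 1`, `hfar` at `Rσ₀`, numerics `0 ≤ α < R` and `2·max(K̄_glued, 1)·(e^{−(ε₀−3μ)Rσ₀} + α∕R) ≤ θ₀` ⟹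
`ExistsUniformAcrossSmall (fun s => (𝓜 s).toTorusTerms c) α Rσ₀ θ₀`.  The couplings `λ_S, λ_R` are fixed letters (only `q < 1`
constrains `λ_R`); the σ-line is met by `Rσ₀` large and `α∕R` small — print's two sources of smallness ([II] p. 13, p. 15–16). -/
theorem acrossSmall_glued {S : Type*} (𝓜 : S → GluedModelMember d) {R lamS lamR r : ℝ} {mJ nD mN : ℕ}
    {ρ₀ ε₀ κ₀ μ cμ Rσ₀ α θ₀ : ℝ}
    (hmN : ∀ s (i : (𝓜 s).ι), ((𝓜 s).t i).mN = mN)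
    (hS : ∀ s (i : (𝓜 s).ι), ((𝓜 s).t i).S.IsDomainLocal c ((𝓜 s).t i).locΛ ((𝓜 s).t i).locN ((𝓜 s).t i).X R lamS r mJ nD)
    (hR : ∀ s (i : (𝓜 s).ι), ((𝓜 s).t i).R.IsDomainLocal c ((𝓜 s).t i).locN ((𝓜 s).t i).locN ((𝓜 s).t i).X R lamR r mJ nD)
    (hrow : ∀ s, RowSum (toB6 (torusGeom (𝓜 s).Nf 0 0 0) 0 True) μ cμ)
    (hfar : ∀ s (i : (𝓜 s).ι) (b : ((𝓜 s).t i).Λ), ∀ z ∈ ((𝓜 s).t i).X, Rσ₀ ≤ tdist1 (𝓜 s).Nf (((𝓜 s).t i).locΛ b) z)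
    (hκ₁ : 0 ≤ c.κ₁) (hlamS : 0 ≤ lamS) (hlamR : 0 ≤ lamR) (hμ : 0 ≤ μ) (hμε : 3 * μ ≤ ε₀) (hμκ : 2 * μ < κ₀)
    (hwin : κ₀ + μ ≤ ρ₀ - ε₀) (hcμ : 0 ≤ cμ)
    (hq : (mN * cμ) * ((mN * cμ) * 1 *
      (1 * ((lamR * Real.exp (c.κ₁ * mJ) * Real.exp (2 * ρ₀ * r)) * Real.exp (μ * r) * (nD * cμ))) * cμ) * cμ < 1)
    (hα : 0 ≤ α) (hαR : α < R)
    (hθ : 2 * max ((mN * cμ) * ((lamS * Real.exp (c.κ₁ * mJ) * Real.exp (2 * ρ₀ * r)) * Real.exp (μ * r) * (nD * cμ)) *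
          (1 * (1 - (mN * cμ) * ((mN * cμ) * 1 *
            (1 * ((lamR * Real.exp (c.κ₁ * mJ) * Real.exp (2 * ρ₀ * r)) * Real.exp (μ * r) * (nD * cμ))) * cμ) * cμ)⁻¹) * cμ) 1
        * (Real.exp (-((ε₀ - 3 * μ) * Rσ₀)) + α / R) ≤ θ₀) :
    ExistsUniformAcrossSmall (fun s => (𝓜 s).toTorusTerms c) α Rσ₀ θ₀ := by
  have hq1 : 0 < 1 - (mN * cμ) * ((mN * cμ) * 1 *
      (1 * ((lamR * Real.exp (c.κ₁ * mJ) * Real.exp (2 * ρ₀ * r)) * Real.exp (μ * r) * (nD * cμ))) * cμ) * cμ := by linarith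
  have hK : 0 ≤ (mN * cμ) * ((lamS * Real.exp (c.κ₁ * mJ) * Real.exp (2 * ρ₀ * r)) * Real.exp (μ * r) * (nD * cμ)) *
      (1 * (1 - (mN * cμ) * ((mN * cμ) * 1 *
        (1 * ((lamR * Real.exp (c.κ₁ * mJ) * Real.exp (2 * ρ₀ * r)) * Real.exp (μ * r) * (nD * cμ))) * cμ) * cμ)⁻¹) * cμ := by
    positivity
  refine acrossSmall_of_decay
    ⟨R, ε₀ - 3 * μ, κ₀ - 2 * μ,
      (mN * cμ) * ((lamS * Real.exp (c.κ₁ * mJ) * Real.exp (2 * ρ₀ * r)) * Real.exp (μ * r) * (nD * cμ)) *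
        (1 * (1 - (mN * cμ) * ((mN * cμ) * 1 *
          (1 * ((lamR * Real.exp (c.κ₁ * mJ) * Real.exp (2 * ρ₀ * r)) * Real.exp (μ * r) * (nD * cμ))) * cμ) * cμ)⁻¹) * cμ,
      1, 1, Rσ₀⟩
    ⟨hαR, by linarith, by linarith, hK, zero_le_one, zero_le_one, le_rfl⟩ (fun s i => ?_) (le_max_left _ _)
    (le_max_right _ _) hα hθ
  have h := GluedModelTerm.termWalkData (hS s i) (hR s i) hκ₁ hlamS hlamR hμ hμε hμκ.le hwin hcμ (hrow s)
    (by rw [hmN s i]; exact hq) (hfar s i)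
  rw [hmN s i] at h
  exact h

end Across

end Summit.QuantumFields.BalabanUV.Gaps.D4WalkModelGlued

end
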